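import Literature.Analysis.FluidPDE.VasseurLevelSetRecurrence
import HarnessLib

/-!
# Vasseur's level-set energies up to a terminal time and the backward recurrence inequality

Companion to `Literature.Analysis.FluidPDE.VasseurLevelSetRecurrence` (same source, same
namespace `Literature.Analysis.FluidPDE.Vasseur2007`, whose vocabulary — `level`, `radius`,
`startTime`, `trunc`, `gradTruncSq`, `levelEnergy`, `pressureNorm`, `LevelSetRecurrence` — is
reused, never restated).

Source: A. F. Vasseur, *A new proof of partial regularity of solutions to Navier–Stokes
equations*, NoDEA **14** (2007) 753–785 [Vasseur2007] (page numbers: the held preprint,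
`lit read doi:10.1007/s00030-007-6001-4`): the level-set objects `B_k`, `T_k`, `Q_k = [T_k, 1] × B_k`,
`v_k`, `d_k`, `U_k` of §2 (p. 4), the recurrence (5) of Proposition 3 (p. 5, PROVED with some
`β_p > 1` under `U_0 ≤ 1`) and its `ε`-rescaled form for the system (30)–(31) of the Appendix
(p. 29). The BACKWARD normalisation (cylinders ending at the reference time `0`, slab
`[-1, 0]`) is the one of the De Giorgi iteration in A. Vasseur, J. Yang, ARMA **241** (2021), §5
[VasseurYang2021] (`Q_k = (-T_k, 0) × B_k`), here with Vasseur's 2007 radii and initial times.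

## What this file provides (definitions with bodies + proved API; NO named fact, NO conjecture)

* `Vasseur2007.levelEnergyUntil τ u k : ℝ≥0∞` — the level-set energy `U_k` computed on the
  cylinder `[T_k, τ] × B_k` ending at a terminal time `τ`:
  `sup_{t ∈ [T_k, τ]} ∫_{B_k} v_k² + ∫∫_{[T_k, τ] × B_k} d_k²`. For `τ = 1` it is
  DEFINITIONALLY the accepted `levelEnergy u k` (`levelEnergyUntil_one`, `rfl`); `τ = 0` gives
  the backward cylinders `Q_k⁻ = [T_k, 0] × B_k ⊆ [-1, 0] × B(1)`. Monotone in `τ`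
  (`levelEnergyUntil_mono`), so `U_k⁻ ≤ U_k` (`levelEnergyUntil_le_levelEnergy`).
* `Vasseur2007.pressureNormOn I P p : ℝ` — `‖P‖_{Lᵖ(I; L¹(B(1)))}` over a time set `I`; for
  `I = (-1, 1)` DEFINITIONALLY the accepted `pressureNorm P p` (`pressureNormOn_Ioo`, `rfl`).
* `Vasseur2007.backwardCylinder_subset` — `[-1/2, 0] × B(1/2) ⊆ Q_k⁻ ⊆ [-1, 0] × B(1)`.
* `Vasseur2007.BackwardLevelSetRecurrence p C β : Prop` — the PARAMETRISED backward recurrence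
  predicate: for every `0 < ε ≤ 1`, every classical solution `(w, q)` of Navier–Stokes (`ν = 1`,
  `f = 0`) on a time set `S ⊇ [-1, 0]`, with `u = ε w`, `P = ε² q` (a solution of (30)–(31) on
  `[-1, 0] × B(1)`), IF `U_0⁻ ≤ 1` THEN for every `k ≥ 1`,
  `U_k⁻ ≤ (Cᵏ/ε) (1 + ‖P‖_{Lᵖ(-1,0; L¹(B(1)))}) (U_{k-1}⁻)^β`.
  It is a definition (a property of `(p, C, β)`), not an assertion; `BackwardLevelSetRecurrence.mono`.

## Relation to `LevelSetRecurrence` and why a second predicate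

`LevelSetRecurrence p C β` (accepted) is the verbatim-normalised shape: forward cylinders
`[T_k, 1] × B_k` in the slab `[-1, 1]`, `0 < ε < 1`, and NO smallness hypothesis (as Conj. 14 is
printed, p. 29). `BackwardLevelSetRecurrence p C β` differs in exactly three points, all asked
for by its requester (route `DeGiorgiThreeHalves` of `Summits/NavierStokesRegularity`, item
`defn-VasseurLevelSetCascade`, "Vasseur–Yang 2021 §5 normalisation"): (i) the cylinders end at
the reference time `0` and the solution is only required on `[-1, 0]` (backward data, as consumed
at a putative blow-up time); (ii) the inequality is only required under Proposition 3's own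
hypothesis `U_0 ≤ 1` (p. 5: "if `U_0 ≤ 1` then we have for every `k > 0` …") — the regime in
which (5) is proved for `β_p` and the only regime the Appendix uses ((32), p. 30, forces
`U_{ε,0} ≤ ε^{1/(β-1)} ≤ 1`); (iii) `ε = 1` is allowed (levels `L = ε⁻¹ ≥ 1`). The two cylinder
families are not related by a symmetry of the equations (time translation moves `[T_k, 1]` to
`[T_k - 1, 0] ≠ [T_k, 0]`; parabolic scaling changes the radii), so neither predicate is a formal
consequence of the other; both are implied, parameter for parameter, by the corresponding
printed-class statements (local suitable weak solutions ⊇ rescaled classical ones, Design choice 1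
of the companion file). LEVEL FORM: with `L = ε⁻¹` and `(w, q)` the classical solution,
`v_k[εw] = ε (|w| - L C_k)₊`, `U_k[εw] = ε² U_k^{(L)}[w]` (truncation at the levels `L C_k`),
`‖ε² q‖ = L⁻² ‖q‖`; the inequality reads `U_k^{(L)} ≤ Cᵏ L^{3-2β} (1 + L⁻² ‖q‖) (U_{k-1}^{(L)})^β`
and the hypothesis reads `U_0^{(L)}[w] ≤ L²` — the requester's "smooth level form".

## What is deliberately NOT here

* The closed super-critical statement `∃ p > 1, ∃ C > 0, ∃ β > 3/2, BackwardLevelSetRecurrence p C β`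
  (the requester's `VasseurLevelSetCascade`; Vasseur's OPEN Conjecture 14 in backward smooth form)
  is not a theorem of any source and is therefore not declared under `Literature/` (CONVENTIONS §4:
  conjectures are obligations of our theories, `Summits/NavierStokesRegularity/…/Theorems/`, or the
  `--conditional-on` premise of a route); over this vocabulary it is the one-line `Prop` above.
* No suitable-weak-solution version, no Proposition 3 / Lemma 4 / Theorem 1 as named facts (no
  requester; see the companion file).

## Design notes

* `ℝ≥0∞`-valued energies, classical `fderiv`s and the junk conventions of `trunc` / `gradTruncSq`
  are those of the companion file (its Design choices 2 and 4); in particular `U_0⁻` is the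
  companion's `d_0²`-energy, equal to `sup ∫ |u|² + ∫∫ |∇u|²` for `C¹` fields up to the null set
  `{u = 0, ∇u ≠ 0}`.
* The pressure time-interval is the whole backward slab `(-1, 0)` (larger interval, larger norm,
  weaker inequality; companion Design choice 3).
-/

noncomputable section

open _root_.MeasureTheory
open scoped ENNReal

namespace Literature.Analysis.FluidPDE.Vasseur2007

/-- Physical space `ℝ³`. -/
local notation "ℝ³" => EuclideanSpace ℝ (Fin 3)

/-! ### Level-set energies up to a terminal time -/

/-- The `k`-th level-set energy on the cylinder `[T_k, τ] × B_k` ending at the terminal time `τ`: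
`U_k(τ) = sup_{t ∈ [T_k, τ]} ∫_{B_k} v_k(t, x)² dx + ∫_{T_k}^{τ} ∫_{B_k} d_k(t, x)² dx dt ∈ [0, ∞]`
(`τ = 1`: Vasseur's `U_k` on `Q_k = [T_k, 1] × B_k`, definitionally `levelEnergy u k`;
`τ = 0`: the backward cylinders ending at the reference time, as in Vasseur–Yang 2021, §5).
A true supremum and lower Lebesgue integrals, as for `levelEnergy`. [cite: Vasseur2007, §2 (p. 4)] -/
def levelEnergyUntil (τ : ℝ) (u : ℝ → ℝ³ → ℝ³) (k : ℕ) : ℝ≥0∞ :=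
  (⨆ t ∈ Set.Icc (startTime k) τ,
      ∫⁻ x in Metric.ball (0 : ℝ³) (radius k), ENNReal.ofReal (trunc u k t x ^ 2)) +
    ∫⁻ z in Set.Icc (startTime k) τ ×ˢ Metric.ball (0 : ℝ³) (radius k),
      ENNReal.ofReal (gradTruncSq u k z.1 z.2)

/-- For the terminal time `τ = 1` the energy is Vasseur's `U_k` (`levelEnergy`), by `rfl`. [cite: Vasseur2007, §2 (p. 4)] -/
@[simp] theorem levelEnergyUntil_one (u : ℝ → ℝ³ → ℝ³) (k : ℕ) :
    levelEnergyUntil 1 u k = levelEnergy u k :=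
  rfl

/-- At `k = 0` there is no truncation: `U_0(τ) = sup_{t ∈ [-1, τ]} ∫_{B(1)} |u|² + ∫∫_{[-1, τ] × B(1)} d_0²`
(`v_0 = |u|`, `T_0 = -1`, `B_0 = B(1)`; `d_0² = |∇u|²` off `{u = 0}`, `gradTruncSq_level_zero`). [cite: Vasseur2007, §2 (p. 4)] -/
theorem levelEnergyUntil_level_zero (τ : ℝ) (u : ℝ → ℝ³ → ℝ³) :
    levelEnergyUntil τ u 0 =
      (⨆ t ∈ Set.Icc (-1 : ℝ) τ, ∫⁻ x in Metric.ball (0 : ℝ³) 1, ENNReal.ofReal (‖u t x‖ ^ 2)) +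
        ∫⁻ z in Set.Icc (-1 : ℝ) τ ×ˢ Metric.ball (0 : ℝ³) 1,
          ENNReal.ofReal (gradTruncSq u 0 z.1 z.2) := by
  simp [levelEnergyUntil]

/-- The energies increase with the terminal time (larger time range in the supremum and in the
dissipation integral). [cite: Vasseur2007, §2 (p. 4)] -/
theorem levelEnergyUntil_mono (u : ℝ → ℝ³ → ℝ³) (k : ℕ) :
    Monotone fun τ => levelEnergyUntil τ u k := by
  intro τ τ' h
  exact add_le_add (biSup_mono fun t ht => Set.Icc_subset_Icc_right h ht)
    (lintegral_mono_set (Set.prod_mono (Set.Icc_subset_Icc_right h) le_rfl))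

/-- In particular the backward energies are dominated by Vasseur's: `U_k(τ) ≤ U_k` for `τ ≤ 1`. [cite: Vasseur2007, §2 (p. 4)] -/
theorem levelEnergyUntil_le_levelEnergy (u : ℝ → ℝ³ → ℝ³) (k : ℕ) {τ : ℝ} (hτ : τ ≤ 1) :
    levelEnergyUntil τ u k ≤ levelEnergy u k :=
  levelEnergyUntil_mono u k hτ

/-- All energies of the rest state vanish, for every terminal time: `U_k(τ)(0) = 0`. [cite: Vasseur2007, §2 (p. 4)] -/
theorem levelEnergyUntil_zero_flow (τ : ℝ) (k : ℕ) : levelEnergyUntil τ (fun _ _ => 0) k = 0 := by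
  have hv : ∀ t (x : ℝ³), trunc (fun _ _ => (0 : ℝ³)) k t x = 0 := fun t x =>
    trunc_eq_zero_iff.2 (by simpa using level_nonneg k)
  have hd : ∀ t (x : ℝ³), gradTruncSq (fun _ _ => (0 : ℝ³)) k t x = 0 := fun t x => by
    simp [gradTruncSq, hv]
  simp [levelEnergyUntil, hv, hd]

/-- The backward cylinders do not shrink to a point either:
`[-1/2, 0] × B(1/2) ⊆ Q_k⁻ = [T_k, 0] × B_k ⊆ [-1, 0] × B(1)` for every `k`
(the backward counterpart of `cylinder_subset`). [cite: Vasseur2007, §2 (p. 5)] -/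
theorem backwardCylinder_subset (k : ℕ) :
    Set.Icc (-(1 / 2) : ℝ) 0 ×ˢ Metric.ball (0 : ℝ³) (1 / 2) ⊆
        Set.Icc (startTime k) 0 ×ˢ Metric.ball (0 : ℝ³) (radius k) ∧
      Set.Icc (startTime k) 0 ×ˢ Metric.ball (0 : ℝ³) (radius k) ⊆
        Set.Icc (-1 : ℝ) 0 ×ˢ Metric.ball (0 : ℝ³) 1 :=
  ⟨Set.prod_mono (Set.Icc_subset_Icc_left (startTime_lt k).le)
      (Metric.ball_subset_ball (half_lt_radius k).le),
    Set.prod_mono (Set.Icc_subset_Icc_left (neg_one_le_startTime k))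
      (Metric.ball_subset_ball (radius_le_one k))⟩

/-! ### The pressure norm over a time set -/

/-- The pressure norm `‖P‖_{Lᵖ(I; L¹(B(1)))} = (∫_I (∫_{B(1)} |P| dx)ᵖ dt)^{1/p}` over a time set
`I` (Theorem 1, eq. (3), integrates over `(-1, 1)`: `pressureNormOn (Set.Ioo (-1) 1) = pressureNorm`
by `rfl`; the backward recurrence uses `I = (-1, 0)`). [cite: Vasseur2007, Theorem 1 eq. (3) (p. 2)] -/
def pressureNormOn (I : Set ℝ) (P : ℝ → ℝ³ → ℝ) (p : ℝ) : ℝ :=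
  (∫ t in I, (∫ x in Metric.ball (0 : ℝ³) 1, ‖P t x‖) ^ p) ^ (1 / p)

/-- Over `(-1, 1)` the norm is the accepted `pressureNorm`, by `rfl`. [cite: Vasseur2007, Theorem 1 eq. (3) (p. 2)] -/
@[simp] theorem pressureNormOn_Ioo (P : ℝ → ℝ³ → ℝ) (p : ℝ) :
    pressureNormOn (Set.Ioo (-1) 1) P p = pressureNorm P p :=
  rfl

/-- The pressure norm is non-negative (real powers of non-negative reals). [folklore] -/
theorem pressureNormOn_nonneg (I : Set ℝ) (P : ℝ → ℝ³ → ℝ) (p : ℝ) : 0 ≤ pressureNormOn I P p :=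
  Real.rpow_nonneg (integral_nonneg fun _ => Real.rpow_nonneg
    (integral_nonneg fun _ => norm_nonneg _) _) _

/-! ### The backward recurrence inequality -/

/-- **Vasseur's level-set recurrence in BACKWARD smooth form, with parameters `(p, C, β)`** (the
shape of inequality (5) of Proposition 3 in the `ε`-rescaled form of the Appendix, on cylinders
ending at the reference time and under Proposition 3's hypothesis `U_0 ≤ 1`): for every
`0 < ε ≤ 1`, every classical solution `(w, q)` of the Navier–Stokes system with `ν = 1`, `f = 0`
on a time set `S ⊇ [-1, 0]` — so that `(u, P) = (ε w, ε² q)` solves the rescaled system (30)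
`∂ₜu + ε⁻¹ div(u ⊗ u) + ε⁻¹ ∇P − Δu = 0`, `div u = 0` on `[-1, 0] × B(1)` with the local energy
equality, hence (31) — IF `U_0⁻ ≤ 1` THEN for every `k ≥ 1`
`U_k⁻ ≤ (Cᵏ / ε) (1 + ‖P‖_{Lᵖ(-1,0; L¹(B(1)))}) · (U_{k-1}⁻)^β`,
where `U_k⁻ = levelEnergyUntil 0 u k` are the energies on `Q_k⁻ = [T_k, 0] × B_k`. Equivalently
(level form, `L = ε⁻¹ ≥ 1`): `U_k^{(L)}[w] ≤ Cᵏ L^{3-2β} (1 + L⁻² ‖q‖) (U_{k-1}^{(L)}[w])^β`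
whenever `U_0^{(L)}[w] ≤ L²`, the truncations being taken at the levels `L (1 - 2⁻ᵏ)`. The
source PROVES this shape (forward cylinders, all local suitable weak solutions) at `ε = 1` under
`U_0 ≤ 1` with some `1 < β_p < 3/2` (Proposition 3); the Appendix (pp. 29–30) shows that a
`β > 3/2` would make every finite-energy suitable weak solution locally bounded, which is not
established. Compare the accepted forward predicate `LevelSetRecurrence` (cylinders `[T_k, 1] × B_k`,
`0 < ε < 1`, no smallness hypothesis, as Conj. 14 is printed); see the module docstring for why
neither implies the other formally. This `def` is the predicate only; no instance of it is
asserted here. [cite: Vasseur2007, Proposition 3 eq. (5) (p. 5); Appendix (30)–(32) (pp. 29–30)] -/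
def BackwardLevelSetRecurrence (p C β : ℝ) : Prop :=
  ∀ ε : ℝ, 0 < ε → ε ≤ 1 →
    ∀ (S : Set ℝ) (w : ℝ → ℝ³ → ℝ³) (q : ℝ → ℝ³ → ℝ), Set.Icc (-1 : ℝ) 0 ⊆ S →
      IsClassicalNSSolutionOn S 1 0 w q →
        levelEnergyUntil 0 (fun t x => ε • w t x) 0 ≤ 1 →
          ∀ k : ℕ, 1 ≤ k →
            levelEnergyUntil 0 (fun t x => ε • w t x) k ≤
              ENNReal.ofReal
                  (C ^ k / ε * (1 + pressureNormOn (Set.Ioo (-1 : ℝ) 0) (fun t x => ε ^ 2 * q t x) p)) *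
                levelEnergyUntil 0 (fun t x => ε • w t x) (k - 1) ^ β

/-- Monotonicity in the constant: if the backward recurrence holds with `C ≥ 0` it holds with
every `C' ≥ C` (both sides are monotone in the prefactor). [folklore] -/
theorem BackwardLevelSetRecurrence.mono {p C C' β : ℝ} (h : BackwardLevelSetRecurrence p C β)
    (hC : 0 ≤ C) (hCC' : C ≤ C') : BackwardLevelSetRecurrence p C' β := by
  intro ε hε hε1 S w q hS hsol h0 k hk
  refine (h ε hε hε1 S w q hS hsol h0 k hk).trans ?_
  gcongr
  exact add_nonneg zero_le_one (pressureNormOn_nonneg _ _ _)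

end Literature.Analysis.FluidPDE.Vasseur2007

end
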